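import Summits.MatrixMultiplication.MatrixMultiplication.Theorems.PairwiseCurvedTilingsLC.Negative.ClearDenominators
import Summits.MatrixMultiplication.MatrixMultiplication.Theorems.PairwiseCurvedTilingsLC.Negative.EvalOfMemSpan
import Mathlib.RingTheory.Localization.FractionRing
import Mathlib.RingTheory.Ideal.Maximal
import Mathlib.RingTheory.Ideal.Quotient.Operations
import Mathlib.RingTheory.MvPolynomial.Basic
import Mathlib.Algebra.MvPolynomial.Equiv
import Mathlib.Algebra.MvPolynomial.PDeriv
import Mathlib.Algebra.Polynomial.Derivative
import Mathlib.FieldTheory.Perfect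
import Mathlib.FieldTheory.Separable
import Mathlib.RingTheory.Radical.Basic
import Mathlib.RingTheory.Polynomial.UniqueFactorization
import Mathlib.Algebra.CharP.Algebra

/-!
# Generic simple roots (line LonelyTranslates c1, Prop27Reduction: the algebraic core)

Crux stmt-MatrixMultiplication-17883 `PairwiseCurvedTilingsLC`, registered stub `stub_relGen`.

**Theorem** (`stub_relGen`, one polynomial at a time in `relGen_single`).  Let `K` be a field of
characteristic `0`, `R = K[u_1, …, u_e]`, `F = Frac R`, and let `D_1, …, D_k ∈ K[u, w]` be such
that their images under the canonical map `toFw : K[u, w] → F[w]` generate a MAXIMAL ideal `I`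
(so `T = F[w]/I` is a field, of characteristic `0`).  For `G_1, …, G_L ∈ K[u, w][s]` there are
`ρ ∈ R ∖ 0` and `H_1, …, H_L ∈ K[u, w][s]` such that at every `K`-point `x` of `{D = 0}` with
`ρ(u(x)) ≠ 0`: (R1) every root of `H_l(x, ·)` is a root of `G_l(x, ·)`; (R2) if `G_l(x, ·)` has a
root in `K` so does `H_l(x, ·)`; (R3) every root of `H_l(x, ·)` in `K` is simple.

Proof.  Reduce `G_l` to `g ∈ T[s]`.  If `g = 0`, all coefficients of `toFw(G_l)` lie in `I`, so
`G_l(x, ·) ≡ 0` off a hypersurface (`stub_eval_eq_zero_of_mem_span`) and `H_l := s` works.  If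
`g ≠ 0`, take its radical `h` (`exists_radical_package`: `g = h c`, `h^{n+1} = g d`,
`a h + a' h' = 1`, the last because `T` is perfect), lift `h, c, d, a, a'` to `F[w][s]`, clear
denominators with one `b ∈ R ∖ 0` (`stub_clearDenominators`), and test the three identities
`b² G − H₀ C₀`, `H₀^{n+1} − bⁿ G D₀`, `A₀ H₀ + A₀' H₀' − b²`: their images in `F[w][s]` reduce to
`0` in `T[s]`, so their coefficients lie in `I` and they vanish at the `K`-points of the chart off
a hypersurface (`stub_eval_eq_zero_of_mem_span`); the evaluated identities give (R1)–(R3).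
-/

set_option linter.dupNamespace false

namespace Summit.MatrixMultiplication.MatrixMultiplication.Theorems.PairwiseCurvedTilingsLC.Negative

open Polynomial

/-! ### The radical package over a field of characteristic zero -/

/-- Over a field of characteristic `0`, every non-zero polynomial `g` has a separable "radical"
`h` with the same roots: `h ∣ g`, `g ∣ h^(n+1)`, and a Bézout identity `a h + a' h' = 1`. [folklore] -/
theorem exists_radical_package {T : Type} [Field T] [CharZero T] {g : T[X]} (hg : g ≠ 0) :
    ∃ (h c d a a' : T[X]) (n : ℕ), g = h * c ∧ h ^ (n + 1) = g * d ∧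
      a * h + a' * derivative h = 1 := by
  classical
  obtain ⟨c, hc⟩ := (UniqueFactorizationMonoid.radical_dvd_self : UniqueFactorizationMonoid.radical g ∣ g)
  obtain ⟨n, hn⟩ := UniqueFactorizationMonoid.exists_dvd_radical_self_pow hg
  obtain ⟨d, hd⟩ := hn
  have hsep : (UniqueFactorizationMonoid.radical g).Separable :=
    PerfectField.separable_iff_squarefree.2 UniqueFactorizationMonoid.squarefree_radical
  obtain ⟨a, a', hbez⟩ := hsep
  refine ⟨UniqueFactorizationMonoid.radical g, c, UniqueFactorizationMonoid.radical g * d, a, a', n,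
    hc, ?_, hbez⟩
  rw [pow_succ, hd]
  ring

/-! ### The generic-simple-roots theorem -/

section RelGen

variable {K : Type} [Field K] {e k : ℕ}

/-- The canonical map `K[u, w] → F[w]` on `u`-only polynomials: `toFw (b(u)) = C (b/1)`. [folklore] -/
theorem aeval_sumElim_rename_inl (b : MvPolynomial (Fin e) K) :
    MvPolynomial.aeval (Sum.elim
        (fun i => MvPolynomial.C (algebraMap (MvPolynomial (Fin e) K)
          (FractionRing (MvPolynomial (Fin e) K)) (MvPolynomial.X i)))
        (fun j => MvPolynomial.X j)) (MvPolynomial.rename (Sum.inl : Fin e → Fin e ⊕ Fin k) b) =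
      (MvPolynomial.C (algebraMap (MvPolynomial (Fin e) K)
          (FractionRing (MvPolynomial (Fin e) K)) b) :
        MvPolynomial (Fin k) (FractionRing (MvPolynomial (Fin e) K))) := by
  rw [MvPolynomial.aeval_rename]
  have hcomp : (Sum.elim
        (fun i => MvPolynomial.C (algebraMap (MvPolynomial (Fin e) K)
          (FractionRing (MvPolynomial (Fin e) K)) (MvPolynomial.X i)))
        (fun j => MvPolynomial.X j)) ∘ (Sum.inl : Fin e → Fin e ⊕ Fin k) =
      fun i => (MvPolynomial.C (algebraMap (MvPolynomial (Fin e) K)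
          (FractionRing (MvPolynomial (Fin e) K)) (MvPolynomial.X i)) :
            MvPolynomial (Fin k) (FractionRing (MvPolynomial (Fin e) K))) := by
    funext i; rfl
  rw [hcomp]
  have key : (MvPolynomial.aeval (fun i => (MvPolynomial.C (algebraMap (MvPolynomial (Fin e) K)
          (FractionRing (MvPolynomial (Fin e) K)) (MvPolynomial.X i)) :
            MvPolynomial (Fin k) (FractionRing (MvPolynomial (Fin e) K)))) :
        MvPolynomial (Fin e) K →ₐ[K] MvPolynomial (Fin k) (FractionRing (MvPolynomial (Fin e) K))) =
      ((Algebra.ofId (FractionRing (MvPolynomial (Fin e) K))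
          (MvPolynomial (Fin k) (FractionRing (MvPolynomial (Fin e) K)))).restrictScalars K).comp
        (IsScalarTower.toAlgHom K (MvPolynomial (Fin e) K) (FractionRing (MvPolynomial (Fin e) K))) :=
    MvPolynomial.algHom_ext fun i => by simp
  have := AlgHom.congr_fun key b
  simpa using this


/-- **Generic simple roots, one polynomial.** See `stub_relGen`. [folklore] -/
theorem relGen_single [CharZero K] (D : Fin k → MvPolynomial (Fin e ⊕ Fin k) K)
    (hmax : (Ideal.span (Set.range fun j => MvPolynomial.aeval
      (Sum.elim (fun i => MvPolynomial.C (algebraMap (MvPolynomial (Fin e) K)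
        (FractionRing (MvPolynomial (Fin e) K)) (MvPolynomial.X i)))
        (fun j => MvPolynomial.X j)) (D j) :
          Set (MvPolynomial (Fin k) (FractionRing (MvPolynomial (Fin e) K))))).IsMaximal)
    (G : Polynomial (MvPolynomial (Fin e ⊕ Fin k) K)) :
    ∃ ρ : MvPolynomial (Fin e) K, ρ ≠ 0 ∧ ∃ H : Polynomial (MvPolynomial (Fin e ⊕ Fin k) K),
      ∀ x : Fin e ⊕ Fin k → K, (∀ j, MvPolynomial.eval x (D j) = 0) →
        MvPolynomial.eval (x ∘ Sum.inl) ρ ≠ 0 →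
          (∀ s, (H.map (MvPolynomial.eval x)).eval s = 0 →
            (G.map (MvPolynomial.eval x)).eval s = 0) ∧
          ((∃ s, (G.map (MvPolynomial.eval x)).eval s = 0) →
            ∃ s, (H.map (MvPolynomial.eval x)).eval s = 0) ∧
          (∀ s, (H.map (MvPolynomial.eval x)).eval s = 0 →
            (derivative (H.map (MvPolynomial.eval x))).eval s ≠ 0) := by
  classical
  set toFw : MvPolynomial (Fin e ⊕ Fin k) K →ₐ[K]
      MvPolynomial (Fin k) (FractionRing (MvPolynomial (Fin e) K)) :=
    MvPolynomial.aeval (Sum.elim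
      (fun i => MvPolynomial.C (algebraMap (MvPolynomial (Fin e) K)
        (FractionRing (MvPolynomial (Fin e) K)) (MvPolynomial.X i)))
      (fun j => MvPolynomial.X j)) with htoFw
  set I : Ideal (MvPolynomial (Fin k) (FractionRing (MvPolynomial (Fin e) K))) :=
    Ideal.span (Set.range fun j => toFw (D j)) with hI
  haveI : I.IsMaximal := hmax
  letI : Field (MvPolynomial (Fin k) (FractionRing (MvPolynomial (Fin e) K)) ⧸ I) := Ideal.Quotient.field I
  haveI : CharZero (MvPolynomial (Fin k) (FractionRing (MvPolynomial (Fin e) K)) ⧸ I) :=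
    charZero_of_injective_algebraMap (R := K) (algebraMap K (MvPolynomial (Fin k) (FractionRing (MvPolynomial (Fin e) K)) ⧸ I)).injective
  -- the reduction map `K[u,w] → T`
  set π : MvPolynomial (Fin e ⊕ Fin k) K →+* MvPolynomial (Fin k) (FractionRing (MvPolynomial (Fin e) K)) ⧸ I :=
    (Ideal.Quotient.mk I).comp toFw.toRingHom with hπ
  have hππ : ∀ P : Polynomial (MvPolynomial (Fin e ⊕ Fin k) K),
      (P.map toFw.toRingHom).map (Ideal.Quotient.mk I) = P.map π := fun P => by
    rw [Polynomial.map_map]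
  -- vanishing of the reduction gives membership of the coefficients
  have hmem : ∀ P : Polynomial (MvPolynomial (Fin k) (FractionRing (MvPolynomial (Fin e) K))),
      P.map (Ideal.Quotient.mk I) = 0 → ∀ i, P.coeff i ∈ I := by
    intro P hP i
    have := congrArg (fun p => p.coeff i) hP
    simp only [Polynomial.coeff_map, Polynomial.coeff_zero] at this
    exact Ideal.Quotient.eq_zero_iff_mem.1 this
  by_cases hg : G.map π = 0
  · -- Case `g = 0`: `G(x, ·) ≡ 0` generically; `H := s`.
    have hQ : ∀ i, (G.map toFw.toRingHom).coeff i ∈ I := hmem _ (by rw [hππ, hg])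
    obtain ⟨b, hb0, hb⟩ := stub_eval_eq_zero_of_mem_span D G hQ
    refine ⟨b, hb0, Polynomial.X, fun x hx hbx => ?_⟩
    have hG0 : G.map (MvPolynomial.eval x) = 0 := hb x hx hbx
    refine ⟨fun s _ => by rw [hG0, eval_zero], fun _ => ⟨0, by simp⟩, fun s _ => by simp⟩
  · -- Case `g ≠ 0`.
    obtain ⟨h, c, d, a, a', n, hgc, hpow, hbez⟩ := exists_radical_package hg
    have hsurj : Function.Surjective
        (Polynomial.map (Ideal.Quotient.mk I) : Polynomial (MvPolynomial (Fin k) (FractionRing (MvPolynomial (Fin e) K))) → _) :=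
      Polynomial.map_surjective _ Ideal.Quotient.mk_surjective
    obtain ⟨h₁, rfl⟩ := hsurj h
    obtain ⟨c₁, rfl⟩ := hsurj c
    obtain ⟨d₁, rfl⟩ := hsurj d
    obtain ⟨a₁, rfl⟩ := hsurj a
    obtain ⟨a₁', rfl⟩ := hsurj a'
    -- common denominator for the five lifts
    obtain ⟨b, hb0, hbP⟩ := stub_clearDenominators ![h₁, c₁, d₁, a₁, a₁']
    obtain ⟨H₀, hH₀⟩ : ∃ P₀ : Polynomial (MvPolynomial (Fin e ⊕ Fin k) K), P₀.map toFw.toRingHom =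
        Polynomial.C (MvPolynomial.C (algebraMap (MvPolynomial (Fin e) K) (FractionRing (MvPolynomial (Fin e) K)) b)) * h₁ := hbP 0
    obtain ⟨C₀, hC₀⟩ : ∃ P₀ : Polynomial (MvPolynomial (Fin e ⊕ Fin k) K), P₀.map toFw.toRingHom =
        Polynomial.C (MvPolynomial.C (algebraMap (MvPolynomial (Fin e) K) (FractionRing (MvPolynomial (Fin e) K)) b)) * c₁ := hbP 1
    obtain ⟨D₀, hD₀⟩ : ∃ P₀ : Polynomial (MvPolynomial (Fin e ⊕ Fin k) K), P₀.map toFw.toRingHom =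
        Polynomial.C (MvPolynomial.C (algebraMap (MvPolynomial (Fin e) K) (FractionRing (MvPolynomial (Fin e) K)) b)) * d₁ := hbP 2
    obtain ⟨A₀, hA₀⟩ : ∃ P₀ : Polynomial (MvPolynomial (Fin e ⊕ Fin k) K), P₀.map toFw.toRingHom =
        Polynomial.C (MvPolynomial.C (algebraMap (MvPolynomial (Fin e) K) (FractionRing (MvPolynomial (Fin e) K)) b)) * a₁ := hbP 3
    obtain ⟨A₀', hA₀'⟩ : ∃ P₀ : Polynomial (MvPolynomial (Fin e ⊕ Fin k) K), P₀.map toFw.toRingHom =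
        Polynomial.C (MvPolynomial.C (algebraMap (MvPolynomial (Fin e) K) (FractionRing (MvPolynomial (Fin e) K)) b)) * a₁' := hbP 4
    -- the constant `b` seen in `F[w]` and in `K[u,w]`
    set bF : MvPolynomial (Fin k) (FractionRing (MvPolynomial (Fin e) K)) := MvPolynomial.C (algebraMap (MvPolynomial (Fin e) K) (FractionRing (MvPolynomial (Fin e) K)) b)
      with hbF
    set b' : MvPolynomial (Fin e ⊕ Fin k) K := MvPolynomial.rename Sum.inl b with hb'
    have hb'F : toFw.toRingHom b' = bF := aeval_sumElim_rename_inl b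
    have hCb' : (Polynomial.C b').map toFw.toRingHom = Polynomial.C bF := by
      rw [Polynomial.map_C, hb'F]
    -- the three test polynomials and their vanishing reductions
    set Q₁ : Polynomial (MvPolynomial (Fin e ⊕ Fin k) K) := Polynomial.C b' ^ 2 * G - H₀ * C₀
      with hQ₁
    set Q₂ : Polynomial (MvPolynomial (Fin e ⊕ Fin k) K) :=
      H₀ ^ (n + 1) - Polynomial.C b' ^ n * G * D₀ with hQ₂
    set Q₃ : Polynomial (MvPolynomial (Fin e ⊕ Fin k) K) :=
      A₀ * H₀ + A₀' * derivative H₀ - Polynomial.C b' ^ 2 with hQ₃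
    have hGπ : (G.map toFw.toRingHom).map (Ideal.Quotient.mk I) =
        h₁.map (Ideal.Quotient.mk I) * c₁.map (Ideal.Quotient.mk I) := by rw [hππ]; exact hgc
    have hQ₁mem : ∀ i, (Q₁.map toFw.toRingHom).coeff i ∈ I := by
      apply hmem
      have hq : Q₁.map toFw.toRingHom =
          Polynomial.C bF ^ 2 * (G.map toFw.toRingHom - h₁ * c₁) := by
        rw [hQ₁, Polynomial.map_sub, Polynomial.map_mul, Polynomial.map_mul, Polynomial.map_pow,
          hCb', hH₀, hC₀]
        ring
      rw [hq, Polynomial.map_mul, Polynomial.map_sub, Polynomial.map_mul, hGπ, sub_self, mul_zero]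
    have hQ₂mem : ∀ i, (Q₂.map toFw.toRingHom).coeff i ∈ I := by
      apply hmem
      have hq : Q₂.map toFw.toRingHom =
          Polynomial.C bF ^ (n + 1) * (h₁ ^ (n + 1) - G.map toFw.toRingHom * d₁) := by
        rw [hQ₂, Polynomial.map_sub, Polynomial.map_mul, Polynomial.map_mul, Polynomial.map_pow,
          Polynomial.map_pow, hCb', hH₀, hD₀]
        ring
      rw [hq, Polynomial.map_mul, Polynomial.map_sub, Polynomial.map_mul, Polynomial.map_pow, hππ G,
        ← hpow, Polynomial.map_pow, sub_self, mul_zero]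
    have hQ₃mem : ∀ i, (Q₃.map toFw.toRingHom).coeff i ∈ I := by
      apply hmem
      have hq : Q₃.map toFw.toRingHom =
          Polynomial.C bF ^ 2 * (a₁ * h₁ + a₁' * derivative h₁ - 1) := by
        rw [hQ₃, Polynomial.map_sub, Polynomial.map_add, Polynomial.map_mul, Polynomial.map_mul,
          Polynomial.map_pow, ← Polynomial.derivative_map, hCb', hH₀, hA₀, hA₀',
          Polynomial.derivative_C_mul]
        ring
      rw [hq, Polynomial.map_mul, Polynomial.map_sub, Polynomial.map_add, Polynomial.map_mul,
        Polynomial.map_mul, ← Polynomial.derivative_map, Polynomial.map_one, hbez, sub_self, mul_zero]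
    obtain ⟨b₁, hb₁0, hb₁⟩ := stub_eval_eq_zero_of_mem_span D Q₁ hQ₁mem
    obtain ⟨b₂, hb₂0, hb₂⟩ := stub_eval_eq_zero_of_mem_span D Q₂ hQ₂mem
    obtain ⟨b₃, hb₃0, hb₃⟩ := stub_eval_eq_zero_of_mem_span D Q₃ hQ₃mem
    refine ⟨b * b₁ * b₂ * b₃, mul_ne_zero (mul_ne_zero (mul_ne_zero hb0 hb₁0) hb₂0) hb₃0, H₀,
      fun x hx hρ => ?_⟩
    simp only [map_mul, mul_ne_zero_iff] at hρ
    obtain ⟨⟨⟨hbx, hb₁x⟩, hb₂x⟩, hb₃x⟩ := hρ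
    -- the evaluated identities
    set β : K := MvPolynomial.eval (x ∘ Sum.inl) b with hβ
    have hb'x : (Polynomial.C b').map (MvPolynomial.eval x) = Polynomial.C β := by
      rw [Polynomial.map_C, hb', MvPolynomial.eval_rename]
    have e₁ : Polynomial.C β ^ 2 * G.map (MvPolynomial.eval x) =
        H₀.map (MvPolynomial.eval x) * C₀.map (MvPolynomial.eval x) := by
      have h0 := hb₁ x hx hb₁x
      rw [hQ₁, Polynomial.map_sub, sub_eq_zero, Polynomial.map_mul, Polynomial.map_mul,
        Polynomial.map_pow, hb'x] at h0
      exact h0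
    have e₂ : H₀.map (MvPolynomial.eval x) ^ (n + 1) =
        Polynomial.C β ^ n * G.map (MvPolynomial.eval x) * D₀.map (MvPolynomial.eval x) := by
      have h0 := hb₂ x hx hb₂x
      rw [hQ₂, Polynomial.map_sub, sub_eq_zero, Polynomial.map_mul, Polynomial.map_mul,
        Polynomial.map_pow, Polynomial.map_pow, hb'x] at h0
      exact h0
    have e₃ : A₀.map (MvPolynomial.eval x) * H₀.map (MvPolynomial.eval x) +
        A₀'.map (MvPolynomial.eval x) * derivative (H₀.map (MvPolynomial.eval x)) =
          Polynomial.C β ^ 2 := by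
      have h0 := hb₃ x hx hb₃x
      rw [hQ₃, Polynomial.map_sub, sub_eq_zero, Polynomial.map_add, Polynomial.map_mul,
        Polynomial.map_mul, Polynomial.map_pow, ← Polynomial.derivative_map, hb'x] at h0
      exact h0
    refine ⟨fun s hs => ?_, fun ⟨s, hs⟩ => ⟨s, ?_⟩, fun s hs hder => ?_⟩
    · -- (R1)
      have := congrArg (Polynomial.eval s) e₁
      simp only [eval_mul, eval_pow, eval_C, hs, zero_mul] at this
      exact (mul_eq_zero.1 this).resolve_left (pow_ne_zero _ hbx)
    · -- (R2)
      have := congrArg (Polynomial.eval s) e₂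
      simp only [eval_mul, eval_pow, eval_C, hs, mul_zero, zero_mul] at this
      exact pow_eq_zero_iff (Nat.succ_ne_zero n) |>.1 this
    · -- (R3)
      have := congrArg (Polynomial.eval s) e₃
      simp only [eval_add, eval_mul, eval_pow, eval_C, hs, hder, mul_zero, add_zero] at this
      exact pow_ne_zero _ hbx this.symm

/-- **Generic simple roots** (registered stub `stub_relGen`): finitely many polynomials at once,
with one common exceptional hypersurface `ρ = ∏_l ρ_l`. [folklore] -/
theorem stub_relGen {K : Type} [Field K] [CharZero K] {e k L : ℕ}
    (D : Fin k → MvPolynomial (Fin e ⊕ Fin k) K)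
    (hmax : (Ideal.span (Set.range fun j => MvPolynomial.aeval
      (Sum.elim (fun i => MvPolynomial.C (algebraMap (MvPolynomial (Fin e) K)
        (FractionRing (MvPolynomial (Fin e) K)) (MvPolynomial.X i)))
        (fun j => MvPolynomial.X j)) (D j) :
          Set (MvPolynomial (Fin k) (FractionRing (MvPolynomial (Fin e) K))))).IsMaximal)
    (G : Fin L → Polynomial (MvPolynomial (Fin e ⊕ Fin k) K)) :
    ∃ ρ : MvPolynomial (Fin e) K, ρ ≠ 0 ∧
      ∃ H : Fin L → Polynomial (MvPolynomial (Fin e ⊕ Fin k) K),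
        ∀ x : Fin e ⊕ Fin k → K, (∀ j, MvPolynomial.eval x (D j) = 0) →
          MvPolynomial.eval (x ∘ Sum.inl) ρ ≠ 0 → ∀ l,
            (∀ s, ((H l).map (MvPolynomial.eval x)).eval s = 0 →
              ((G l).map (MvPolynomial.eval x)).eval s = 0) ∧
            ((∃ s, ((G l).map (MvPolynomial.eval x)).eval s = 0) →
              ∃ s, ((H l).map (MvPolynomial.eval x)).eval s = 0) ∧
            (∀ s, ((H l).map (MvPolynomial.eval x)).eval s = 0 →
              (Polynomial.derivative ((H l).map (MvPolynomial.eval x))).eval s ≠ 0) := by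
  classical
  choose ρ hρ0 H hH using fun l => relGen_single D hmax (G l)
  refine ⟨∏ l, ρ l, Finset.prod_ne_zero_iff.2 fun l _ => hρ0 l, H, fun x hx hρx l => ?_⟩
  refine hH l x hx fun h0 => hρx ?_
  rw [map_prod]
  exact Finset.prod_eq_zero (Finset.mem_univ l) h0

end RelGen



end Summit.MatrixMultiplication.MatrixMultiplication.Theorems.PairwiseCurvedTilingsLC.Negative
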